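import Summits.CriticalPhenomena.SAWScalingLimit.Theorems.HexConjecture.Negative.Reversal
import Summits.CriticalPhenomena.SAWScalingLimit.Theorems.ObservableToSLER.Negative.RootPinNecessity

/-!
# `HexConjecture` — the reversibility debt in the language of chordal curve families

Support file for crux `stmt-CriticalPhenomena-0808` (cdisprove, cycle 2), addendum to
`Negative/Reversal.lean`.

* `isSLECurve_iff_of_eq`, `isSLELaw_iff_of_eq` — being a chordal SLE_κ curve / law depends on the
  Dobrushin domain only through `(carrier, pt 0, pt 1)` (transport between two `MarkedDomain 2`
  structures with the same carrier and marked points, e.g. `D'` and `D.swap`).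
* `exists_isEmbEndpointApprox_of_eq_swap` — approximability is likewise a property of
  `(carrier, pt 0, pt 1)`, symmetric under exchanging the marked points.
* `sleFamily`, `exists_reversible_sleFamily_of_hexConjecture` — under `HexConjecture` there is a
  `ChordalFamily` which is a chordal SLE(8/3) law on every Dobrushin domain carrying a hexagonal endpoint
  approximation (junk `0` elsewhere) and which is REVERSIBLE in the sense of
  `ChordalFamily.IsReversible` (`P D' = (P D).map reverse` whenever `D'` is `D` with the marked points
  exchanged) — literally hypothesis (iv) of crux `Rigidity` of route SAWRestrictionRigidity, here a
  CONSEQUENCE of DCS Conjecture 1 as typed.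
-/

noncomputable section

namespace Summit.CriticalPhenomena.SAWScalingLimit.Cruxes.HexConjecture.Reversal

open MeasureTheory Filter Topology Set
open Literature.Probability.LatticeModels Literature.Probability.RandomPlanarGeometry
open Literature.Probability.RandomPlanarGeometry.SAW Literature.Probability.Process
open scoped NNReal ENNReal

/-! ## Transport along `(carrier, pt 0, pt 1)` -/

section Transport

variable {κ : ℝ≥0} {D D' : DobrushinDomain}

/-- Being a chordal SLE_κ curve in `(D; a, b)` depends on `D` only through its carrier and its two
marked points. [folklore] -/
theorem isSLECurve_iff_of_eq (hc : D'.carrier = D.carrier) (h0 : D'.pt 0 = D.pt 0)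
    (h1 : D'.pt 1 = D.pt 1) (Γ : (ℝ≥0 → ℝ) → CurveClass ℂ) :
    IsSLECurve κ D' Γ ↔ IsSLECurve κ D Γ := by
  obtain ⟨⟨c, bd, ho, hb, hconn, hcont, hper, hinj, hrange⟩, mark, hsm, hmem⟩ := D
  obtain ⟨⟨c', bd', ho', hb', hconn', hcont', hper', hinj', hrange'⟩, mark', hsm', hmem'⟩ := D'
  change c' = c at hc
  subst hc
  simp only [MarkedDomain.pt] at h0 h1
  simp only [IsSLECurve, MarkedDomain.IsChordalUniformizing, MarkedDomain.pt, h0, h1]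

/-- Being a chordal SLE_κ law depends on `D` only through `(carrier, pt 0, pt 1)`. [folklore] -/
theorem isSLELaw_iff_of_eq (hc : D'.carrier = D.carrier) (h0 : D'.pt 0 = D.pt 0)
    (h1 : D'.pt 1 = D.pt 1) (μ : Measure (CurveClass ℂ)) :
    IsSLELaw κ D' μ ↔ IsSLELaw κ D μ := by
  simp only [IsSLELaw, isSLECurve_iff_of_eq hc h0 h1]

/-- A domain with the same carrier as `D` and the marked points of `D` exchanged has the SLE laws of
`D.swap`. [folklore] -/
theorem isSLELaw_iff_swap (hc : D'.carrier = D.carrier) (h0 : D'.pt 0 = D.pt 1)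
    (h1 : D'.pt 1 = D.pt 0) (μ : Measure (CurveClass ℂ)) :
    IsSLELaw κ D' μ ↔ IsSLELaw κ D.swap μ :=
  isSLELaw_iff_of_eq (by rw [hc, MarkedDomain.carrier_swap]) (by rw [h0, MarkedDomain.pt_swap_zero])
    (by rw [h1, MarkedDomain.pt_swap_one]) μ

variable {V : Type*} {G : SimpleGraph V} {emb : V → ℂ}

/-- Endpoint approximations transport along `(carrier, pt 0, pt 1)`. [folklore] -/
theorem isEmbEndpointApprox_of_eq (hc : D'.carrier = D.carrier) (h0 : D'.pt 0 = D.pt 0)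
    (h1 : D'.pt 1 = D.pt 1) {a b : ℝ → V} (h : IsEmbEndpointApprox G emb D a b) :
    IsEmbEndpointApprox G emb D' a b where
  reachable := by rw [hc]; exact h.reachable
  tendsto_fst := by rw [h0]; exact h.tendsto_fst
  tendsto_snd := by rw [h1]; exact h.tendsto_snd

/-- Approximability is symmetric under exchanging the marked points (read the approximation
backwards). [folklore] -/
theorem exists_isEmbEndpointApprox_of_eq_swap (hc : D'.carrier = D.carrier) (h0 : D'.pt 0 = D.pt 1)
    (h1 : D'.pt 1 = D.pt 0) (h : ∃ a b : ℝ → V, IsEmbEndpointApprox G emb D a b) :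
    ∃ a b : ℝ → V, IsEmbEndpointApprox G emb D' a b := by
  obtain ⟨a, b, hab⟩ := h
  exact ⟨b, a, isEmbEndpointApprox_of_eq (D := D.swap) (by rw [hc, MarkedDomain.carrier_swap])
    (by rw [h0, MarkedDomain.pt_swap_zero]) (by rw [h1, MarkedDomain.pt_swap_one])
    (isEmbEndpointApprox_swap hab)⟩

end Transport

/-! ## The reversible SLE(8/3) family produced by the crux -/

section Family

open Classical in
/-- The family of laws selected by the crux: on a Dobrushin domain carrying a hexagonal endpoint
approximation, the law of the chordal SLE(8/3) curve which `HexConjecture` provides for (a choice of)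
that approximation; the junk `0` elsewhere. [folklore] -/
def sleFamily (h : Theses.SAWDefectDecoherence.HexConjecture) : ChordalFamily := fun D =>
  if hD : ∃ a b : ℝ → HexVertex, IsEmbEndpointApprox hexGraph hexCenter D a b then
    preWienerMeasure.map (h D hD.choose hD.choose_spec.choose hD.choose_spec.choose_spec).choose
  else 0

/-- On approximable domains the selected law is a chordal SLE(8/3) law. [folklore] -/
theorem isSLELaw_sleFamily (h : Theses.SAWDefectDecoherence.HexConjecture) {D : DobrushinDomain}
    (hD : ∃ a b : ℝ → HexVertex, IsEmbEndpointApprox hexGraph hexCenter D a b) :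
    IsSLELaw ((8 : ℝ≥0) / 3) D (sleFamily h D) := by
  rw [sleFamily, dif_pos hD]
  exact (h D hD.choose hD.choose_spec.choose hD.choose_spec.choose_spec).choose_spec.1.isSLELaw_map

/-- Off approximable domains the selected law is the junk `0`. [folklore] -/
theorem sleFamily_of_not (h : Theses.SAWDefectDecoherence.HexConjecture) {D : DobrushinDomain}
    (hD : ¬ ∃ a b : ℝ → HexVertex, IsEmbEndpointApprox hexGraph hexCenter D a b) :
    sleFamily h D = 0 := by
  rw [sleFamily, dif_neg hD]

/-- **REVERSIBILITY DEBT, family form.** Under `HexConjecture` the selected SLE(8/3) family is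
reversible in the sense of `ChordalFamily.IsReversible`: for `D'` = `D` with the marked points
exchanged, `P D' = (P D).map reverse` (both approximable: `sleLaw_swap_eq_map_reverse_of_hexConjecture`
after transport to `D.swap`; both non-approximable: `0 = 0`). This is hypothesis (iv) of crux
`Rigidity` (route SAWRestrictionRigidity) obtained from DCS Conjecture 1 as typed. [folklore] -/
theorem isReversible_sleFamily (h : Theses.SAWDefectDecoherence.HexConjecture) :
    (sleFamily h).IsReversible := by
  intro D D' hc h0 h1
  by_cases hD : ∃ a b : ℝ → HexVertex, IsEmbEndpointApprox hexGraph hexCenter D a b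
  · have hD' : ∃ a b : ℝ → HexVertex, IsEmbEndpointApprox hexGraph hexCenter D' a b :=
      exists_isEmbEndpointApprox_of_eq_swap hc h0 h1 hD
    have hlaw' : IsSLELaw ((8 : ℝ≥0) / 3) D.swap (sleFamily h D') :=
      (isSLELaw_iff_swap hc h0 h1 _).1 (isSLELaw_sleFamily h hD')
    exact sleLaw_swap_eq_map_reverse_of_hexConjecture h hD (isSLELaw_sleFamily h hD) hlaw'
  · have hD' : ¬ ∃ a b : ℝ → HexVertex, IsEmbEndpointApprox hexGraph hexCenter D' a b := by
      intro hD'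
      refine hD (exists_isEmbEndpointApprox_of_eq_swap hc.symm ?_ ?_ hD')
      · rw [h1]
      · rw [h0]
    rw [sleFamily_of_not h hD, sleFamily_of_not h hD', Measure.map_zero]

/-- **Summary**: under `HexConjecture` there is a chordal family which is a chordal SLE(8/3) law on
every Dobrushin domain carrying a hexagonal endpoint approximation and which is reversible. [folklore] -/
theorem exists_reversible_sleFamily_of_hexConjecture (h : Theses.SAWDefectDecoherence.HexConjecture) :
    ∃ P : ChordalFamily,
      (∀ D : DobrushinDomain, (∃ a b : ℝ → HexVertex, IsEmbEndpointApprox hexGraph hexCenter D a b) →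
        IsSLELaw ((8 : ℝ≥0) / 3) D (P D)) ∧ P.IsReversible :=
  ⟨sleFamily h, fun _ hD => isSLELaw_sleFamily h hD, isReversible_sleFamily h⟩

end Family

end Summit.CriticalPhenomena.SAWScalingLimit.Cruxes.HexConjecture.Reversal
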